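import Literature.NumberTheory.LFunctions.PsdDyadicCertificate
import HarnessLib

/-!
# Format C, component (P): reassembling a row-banded kernel PSD check

Helper file (`--supports stmt-RiemannHypothesis-0098`), RH-free; rh-explicit seat weil-2 (gen 2).  The kernel PSD certificate
`PsdDyadic.checkPsdMid` (`Literature/NumberTheory/LFunctions/PsdDyadicCertificate.lean`) costs `≈ 7·10⁻⁵·n³` s of kernel time in
one `decide`; for the large odd-sector blocks of format C (`n = 192 … 400`) the check is split into a cheap shape file
(`PsdDyadic.checkPsdShape`) and one file per band of rows (`PsdDyadic.checkPsdBand δ ρ mid L i₀ k`).  This file proves that the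
bands reassemble: every band certifies the budgets of its rows (`rowBudget_of_checkPsdBand`), shapes + all row budgets give back
the monolithic check (`checkPsdMid_of_bands`), hence positive semidefiniteness of every enclosed real matrix (`psd_of_bands`,
via `PsdDyadic.psd_of_checkPsdMid`).  Pure bookkeeping; everything here is proved. [folklore]
-/

set_option linter.dupNamespace false

open Finset
open scoped BigOperators

namespace Summit.RiemannHypothesis.RiemannHypothesis.Theorems.FormatCPsd

open Literature.NumberTheory.LFunctions.PsdDyadic

/-- What `checkRowsMid` certifies: equal lengths and every row budget (offset form). [folklore] -/
private theorem checkRowsMid_spec (δ ρ : ℤ) (rows : List (List ℤ)) : ∀ (ms ris : List (List ℤ)) (i₀ : ℕ),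
    checkRowsMid δ ρ rows i₀ ms ris = true →
    ms.length = ris.length ∧ ∀ t < ms.length, rowErrSumMid δ ρ (ris.getD t []) (i₀ + t) 0 (ms.getD t []) rows ≤ δ
  | [], [], i₀, _ => ⟨rfl, fun t ht ↦ absurd ht (Nat.not_lt_zero _)⟩
  | [], _ :: _, i₀, h => by simp [checkRowsMid] at h
  | _ :: _, [], i₀, h => by simp [checkRowsMid] at h
  | mi :: ms, ri :: ris, i₀, h => by
      rw [checkRowsMid, Bool.and_eq_true, decide_eq_true_eq] at h
      obtain ⟨hlen, hrest⟩ := checkRowsMid_spec δ ρ rows ms ris (i₀ + 1) h.2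
      refine ⟨by simp [hlen], fun t ht ↦ ?_⟩
      cases t with
      | zero => simpa using h.1
      | succ t =>
        have := hrest t (by simpa using ht)
        simpa [List.getD_cons_succ, show i₀ + 1 + t = i₀ + (t + 1) by omega] using this

/-- Converse: equal lengths and all row budgets give the Boolean check. [folklore] -/
private theorem checkRowsMid_of_rows (δ ρ : ℤ) (rows : List (List ℤ)) : ∀ (ms ris : List (List ℤ)) (i₀ : ℕ),
    ms.length = ris.length →
    (∀ t < ms.length, rowErrSumMid δ ρ (ris.getD t []) (i₀ + t) 0 (ms.getD t []) rows ≤ δ) →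
    checkRowsMid δ ρ rows i₀ ms ris = true
  | [], [], i₀, _, _ => rfl
  | [], _ :: _, i₀, h, _ => by simp at h
  | _ :: _, [], i₀, h, _ => by simp at h
  | mi :: ms, ri :: ris, i₀, h, hr => by
      rw [checkRowsMid, Bool.and_eq_true, decide_eq_true_eq]
      refine ⟨by simpa using hr 0 (by simp), checkRowsMid_of_rows δ ρ rows ms ris (i₀ + 1) (by simpa using h) fun t ht ↦ ?_⟩
      have := hr (t + 1) (by simpa using ht)
      simpa [List.getD_cons_succ, show i₀ + (t + 1) = i₀ + 1 + t by omega] using this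

/-- **A band certifies its rows**: if `checkPsdBand δ ρ mid L i₀ k = true` then every row `t` with `i₀ ≤ t < i₀ + k` and
`t < mid.length` satisfies its budget `Σ_j (|mid_tj − P_tj| + ρ) ≤ δ`. [folklore] -/
theorem rowBudget_of_checkPsdBand {δ ρ : ℤ} {mid L : List (List ℤ)} {i₀ k : ℕ}
    (h : checkPsdBand δ ρ mid L i₀ k = true) {t : ℕ} (h₁ : i₀ ≤ t) (h₂ : t < i₀ + k) (h₃ : t < mid.length) :
    rowErrSumMid δ ρ (L.getD t []) t 0 (mid.getD t []) L ≤ δ := by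
  obtain ⟨-, hrows⟩ := checkRowsMid_spec δ ρ L _ _ i₀ h
  obtain ⟨s, rfl⟩ : ∃ s, t = i₀ + s := ⟨t - i₀, by omega⟩
  have hs : s < k := by omega
  have hsm : s < ((mid.drop i₀).take k).length := by simp; omega
  have key := hrows s hsm
  have hm : ((mid.drop i₀).take k).getD s [] = mid.getD (i₀ + s) [] := by
    rw [List.getD_eq_getElem?_getD, List.getD_eq_getElem?_getD, List.getElem?_take_of_lt hs, List.getElem?_drop]
  have hL : ((L.drop i₀).take k).getD s [] = L.getD (i₀ + s) [] := by
    rw [List.getD_eq_getElem?_getD, List.getD_eq_getElem?_getD, List.getElem?_take_of_lt hs, List.getElem?_drop]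
  rwa [hm, hL] at key

/-- **Reassembly**: shapes + every row budget give the monolithic check `checkPsdMid`. [folklore] -/
theorem checkPsdMid_of_bands {n : ℕ} {δ ρ : ℤ} {mid L : List (List ℤ)} (hs : checkPsdShape n mid L = true)
    (hr : ∀ t < n, rowErrSumMid δ ρ (L.getD t []) t 0 (mid.getD t []) L ≤ δ) : checkPsdMid n δ ρ mid L = true := by
  unfold checkPsdShape at hs
  simp only [Bool.and_eq_true, decide_eq_true_eq] at hs
  obtain ⟨⟨⟨⟨hml, hLl⟩, hmr⟩, hLr⟩, hsy⟩ := hs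
  unfold checkPsdMid
  simp only [Bool.and_eq_true, decide_eq_true_eq]
  refine ⟨⟨⟨⟨⟨hml, hLl⟩, hmr⟩, hLr⟩, hsy⟩, ?_⟩
  exact checkRowsMid_of_rows δ ρ L mid L 0 (by rw [hml, hLl]) fun t ht ↦ by
    simpa using hr t (by rw [← hml]; exact ht)

/-- **Soundness, banded form**: shapes + all row budgets (from any covering family of bands) + the entrywise enclosure
`|M i j − mid_ij·u| ≤ ρ·u` ⇒ the real symmetric matrix `M` is positive semidefinite as a quadratic form.
[cite: Rump2006PosDef, §2] -/
theorem psd_of_bands {n : ℕ} {δ ρ : ℤ} {mid L : List (List ℤ)} (hs : checkPsdShape n mid L = true)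
    (hr : ∀ t < n, rowErrSumMid δ ρ (L.getD t []) t 0 (mid.getD t []) L ≤ δ) {u : ℝ} (hu : 0 < u)
    (M : Fin n → Fin n → ℝ) (hM : ∀ i j, |M i j - (getMZ mid i j : ℝ) * u| ≤ (ρ : ℝ) * u) (α : Fin n → ℝ) :
    0 ≤ ∑ i, ∑ j, α i * α j * M i j :=
  psd_of_checkPsdMid (checkPsdMid_of_bands hs hr) hu M hM α

end Summit.RiemannHypothesis.RiemannHypothesis.Theorems.FormatCPsd

/-! ## The `O(n²)` shape check implies the indexed one (appended 2026-08-22, weil-2 gen2; needs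
`PsdDyadic.transposeZ` / `checkPsdShapeFast` from the 2026-08-22 append of `PsdDyadicCertificate.lean`) -/

namespace Summit.RiemannHypothesis.RiemannHypothesis.Theorems.FormatCPsd

open Literature.NumberTheory.LFunctions.PsdDyadic

/-- Row count of the transpose of a nonempty matrix with rows of length `c` is `c`. [folklore] -/
private theorem length_transposeZ : ∀ (m : List (List ℤ)) (c : ℕ), m ≠ [] → (∀ x ∈ m, x.length = c) →
    (transposeZ m).length = c
  | [], c, h, _ => absurd rfl h
  | [a], c, _, ha => by simp [transposeZ, ha a (by simp)]
  | a :: b :: u, c, _, ha => by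
      simp only [transposeZ, List.length_zipWith]
      rw [length_transposeZ (b :: u) c (by simp) (fun x hx ↦ ha x (List.mem_cons_of_mem _ hx)), ha a (by simp),
        Nat.min_self]

/-- Entries of the transpose: `(transposeZ m)[j][i] = m[i][j]` for rows of common length `c`. [folklore] -/
private theorem getMZ_transposeZ : ∀ (m : List (List ℤ)) (c : ℕ), (∀ r ∈ m, r.length = c) →
    ∀ i j, i < m.length → j < c → getMZ (transposeZ m) j i = getMZ m i j
  | [], c, _, i, j, hi, _ => absurd hi (Nat.not_lt_zero _)
  | [r], c, hr, i, j, hi, hj => by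
      have hi0 : i = 0 := by simpa using hi
      subst hi0
      have hjr : j < r.length := by rw [hr r (by simp)]; exact hj
      simp [getMZ, transposeZ, List.getD_eq_getElem?_getD, hjr]
  | r :: r' :: rs, c, hr, i, j, hi, hj => by
      have hjr : j < r.length := by rw [hr r (by simp)]; exact hj
      have hrest : ∀ x ∈ r' :: rs, x.length = c := fun x hx ↦ hr x (List.mem_cons_of_mem _ hx)
      have hjT : j < (transposeZ (r' :: rs)).length := by rw [length_transposeZ _ c (by simp) hrest]; exact hj
      have ih := getMZ_transposeZ (r' :: rs) c hrest
      cases i with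
      | zero =>
        simp [getMZ, transposeZ, List.getD_eq_getElem?_getD, hjr, hjT]
      | succ k =>
        have hk : k < (r' :: rs).length := by simpa using hi
        have e := ih k j hk hj
        simpa [getMZ, transposeZ, List.getD_eq_getElem?_getD, hjr, hjT] using e

/-- `allBelowN` from a pointwise hypothesis. [folklore] -/
private theorem allBelowN_of_forall {n : ℕ} {P : ℕ → Bool} (h : ∀ k < n, P k = true) : allBelowN n P = true := by
  induction n with
  | zero => rfl
  | succ n ih =>
    show (allBelowN n P && P n) = true
    rw [Bool.and_eq_true]
    exact ⟨ih fun k hk ↦ h k (by omega), h n (by omega)⟩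

/-- **The fast shape check implies the indexed one** (so `checkPsdMid_of_bands` / `psd_of_bands` apply). [folklore] -/
theorem checkPsdShape_of_fast {n : ℕ} {mid L : List (List ℤ)} (h : checkPsdShapeFast n mid L = true) :
    checkPsdShape n mid L = true := by
  unfold checkPsdShapeFast at h
  simp only [Bool.and_eq_true, decide_eq_true_eq, List.all_eq_true, beq_iff_eq] at h
  obtain ⟨⟨⟨⟨hml, hLl⟩, hmr⟩, hLr⟩, hT⟩ := h
  unfold checkPsdShape
  simp only [Bool.and_eq_true, decide_eq_true_eq, List.all_eq_true]
  refine ⟨⟨⟨⟨hml, hLl⟩, hmr⟩, hLr⟩, ?_⟩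
  unfold symmCheck
  refine allBelowN_of_forall fun i hi ↦ allBelowN_of_forall fun j hj ↦ ?_
  rw [decide_eq_true_eq]
  have key := getMZ_transposeZ mid n hmr j i (by rw [hml]; omega) (by omega)
  rw [hT] at key
  exact key


end Summit.RiemannHypothesis.RiemannHypothesis.Theorems.FormatCPsd
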